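import Summits.HodgeConjecture.HodgeConjecture.Theorems.R90S6ResidualStarFixedRegular   -- ★ 3b: a residually regular `k` fixes no star vertex (`ncard = 0`)
import Summits.HodgeConjecture.HodgeConjecture.Theorems.R90S6TreeFixedPointsConvex       -- ★ W6-c: fixed vertices of a tree automorphism are geodesically convex
import Literature.NumberTheory.Automorphic.UnitaryLatticeTreeRootStarCount                -- ★ `finite_neighborSet_root`
import Literature.NumberTheory.Automorphic.UnitaryLatticeTreeValencyInertPlace            -- ★ `exists_residueField_ringHom_of_v_eq`, `map_mem_integer_of_v_eq`
import HarnessLib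

/-!
# R90 · S6 «Ch. 14.1–14.5 stable trace formula» — S1 regime R-III («all eigenvalues residually separated»): a residually regular type-(1) element fixes EXACTLY ONE
# hyperspecial vertex and NO special vertex — `#Fix(U⧸K₀) = 1`, `#Fix(U⧸K₁) = 0` (`Theorems/R90S6TorusFixedCountsRegular.lean`)

Cell `hodgecm-mathlib`, crux H413 (`stmt-HodgeConjecture-24833`), route of record `HCCMUnconditional`; programme R90-TF, section S6 (base `R90-C14`), seat R90-C14-p05 (g0);
S6 dealer R90-C14-plan (g2) 00:39:05Z «R-III now (`natCard_fixedBy_special_eq_zero_of_residually_regular`: a₁ + a₀ = 1, a₀ ≥ 1 from the root ⇒ a₁ = 0)» (S1 HEADS R0,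
this seat 00:4xZ; DAG r5 row E1.3.5.2.4, the pair `(a₀, a₁)` consumed by W8-f).  Helper lane `--supports stmt-HodgeConjecture-24833 --as helper`; ONE theorem (no definition,
no instance, no notation, no named fact, no `sorry`); imports = ★ `Theorems.R90S6ResidualStarFixedRegular` (3b) + ★ `Theorems.R90S6TreeFixedPointsConvex` (W6-c) + ★
`UnitaryLatticeTreeRootStarCount` + ★ `UnitaryLatticeTreeValencyInertPlace` + HarnessLib.

THE MATHEMATICS [Serre1980Trees, I.6.1, II.1.1; BruhatTits1972, §10; Kottwitz1988, §2].  Unramified datum `hd` with FINITE residue field, `U = U(σ, J₀)(K)`, `K₀ = Stab(L₀)`,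
`K₁ = Stab(g₁·L₀)` (`g₁ = diag(1,1,ϖ)`).  Let `k ∈ K₀` be RESIDUALLY REGULAR in the sense of ★ 3b: an integral frame `P` (`P`, `P⁻¹` integral) with `k·P = P·diag(u)`,
`|u_i − u_j| = 1` (`i ≠ j`) and residually anisotropic eigencolumns — the type-(1) regime R-III «all three eigenvalues residually separated».  Then the fixed-vertex set of `k` on the
lattice tree ★ `latticeGraph σ ϖ J₀` (a tree, ★ `isTree_latticeGraph_three_of_unramified`) is `{L₀}`: the root is fixed (`k ∈ K₀`); by ★ 3b no vertex of the star of the root is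
fixed (its fixed part has `ncard = 0` and the star is finite, ★ `finite_neighborSet_root`); and a fixed vertex `v ≠ L₀` would force the first vertex `z` of the geodesic
`[L₀, v]` — a star vertex with `d(L₀,z) + d(z,v) = d(L₀,v)` — to be fixed (★ W6-c `R90.S6.fixedPoints_convex_of_isTree`), contradiction.  Through the ★ dictionaries
`Fix(U⧸K₀) ≃ fixed self-dual vertices`, `Fix(U⧸K₁) ≃ fixed type-two vertices` (transitivity from `hd`): **`Nat.card Fix_k(U⧸K₀) = 1` and `Nat.card Fix_k(U⧸K₁) = 0`** —
`(a₀, a₁) = (1, 0)`, consistent with ★ FILE 1 (`a₁ + a₀ = 1 + Σ s = 1`).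
HONEST LABEL: lattice-tree bookkeeping over ★ organs; count-neutral until S1∕W8-f consume it; proves no printed statement.  HC_CM is proved only modulo the 7 printed citations
(2 remaining named inputs: hLiu418 = stmt-HodgeConjecture-24832, h413 = stmt-HodgeConjecture-24833) until rung 0 closes.
-/

set_option autoImplicit false
-- the mandated namespace repeats the single-problem summit's segment (`HodgeConjecture.HodgeConjecture`)
set_option linter.dupNamespace false

noncomputable section

open MulAction
open Literature.NumberTheory.Automorphic Literature.NumberTheory.Automorphic.HermitianLattice Literature.NumberTheory.Automorphic.UnitaryGroup
open Literature.NumberTheory.Automorphic.UnitaryLatticeTree Literature.NumberTheory.Automorphic.CartanUnique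
open scoped Matrix MatrixGroups WithZero Valued

namespace Summit.HodgeConjecture.HodgeConjecture.R90.S6

/-- **S1 R-III — A RESIDUALLY REGULAR (TYPE-(1), ALL EIGENVALUES SEPARATED) `k ∈ K₀` FIXES EXACTLY THE ROOT: `#Fix_k(U⧸K₀) = 1`, `#Fix_k(U⧸K₁) = 0`.**  Unramified datum
with finite residue field, `g₁ = diag(1,1,ϖ)`, `k ∈ K₀` with an integral eigenframe of residually distinct eigenvalues and residually anisotropic eigencolumns (the
hypotheses of ★ 3b `R90.S6.ncard_fixed_neighborSet_root_eq_zero_of_residually_regular`).  Proof: root fixed, star unfixed (★ 3b + ★ `finite_neighborSet_root`), convexity of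
the fixed set on the tree (★ W6-c) ⇒ fixed vertices = `{L₀}`; then the ★ fixed-coset ∕ fixed-vertex dictionaries.  SCOPE: `k ∈ K₀` is the HYPERSPECIAL-fixed
realisation, `(a₀, a₁) = (1, 0)`; a residually regular element fixing only a SPECIAL vertex gives `(0, 1)`; the general additive form `a₁ + a₀ = 1` for separated residues is
the G1 sheet v1.1 §4 (J7). [cite: Serre1980Trees, I.6.1, II.1.1] [cite: BruhatTits1972, §10] [cite: Kottwitz1988, §2] -/
theorem natCard_fixedBy_eq_of_residually_regular {K : Type*} [Field K] [Valued K ℤᵐ⁰] [ValuativeRel K] [(Valued.v : Valuation K ℤᵐ⁰).Compatible] [Finite 𝓀[K]]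
    {σ : K →+* K} {ϖ : K} (hd : UnramifiedLocalConjDatum σ ϖ)
    (g₁ : GL (Fin 3) K) (hg₁ : (g₁ : Matrix (Fin 3) (Fin 3) K) = Matrix.diagonal ![(1 : K), 1, ϖ])
    (k : ↥(unitaryGroupOfForm σ ((StdForm.antidiagonal 3).over K))) (hk : k ∈ unitaryInt σ ((StdForm.antidiagonal 3).over K))
    (P : GL (Fin 3) K) (hP : ∀ i j, Valued.v ((P : Matrix (Fin 3) (Fin 3) K) i j) ≤ 1) (hP' : ∀ i j, Valued.v (((P⁻¹ : GL (Fin 3) K) : Matrix (Fin 3) (Fin 3) K) i j) ≤ 1)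
    (u : Fin 3 → K) (hkP : ((k : GL (Fin 3) K) : Matrix (Fin 3) (Fin 3) K) * (P : Matrix (Fin 3) (Fin 3) K) = (P : Matrix (Fin 3) (Fin 3) K) * Matrix.diagonal u)
    (hreg : ∀ i j, i ≠ j → Valued.v (u i - u j) = 1)
    (hanis : ∀ i, Valued.v (B₀ σ 3 ((P : Matrix (Fin 3) (Fin 3) K).mulVec (Pi.single i 1)) ((P : Matrix (Fin 3) (Fin 3) K).mulVec (Pi.single i 1))) = 1) :
    Nat.card (fixedBy (↥(unitaryGroupOfForm σ ((StdForm.antidiagonal 3).over K)) ⧸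
        (glInt 3 K).subgroupOf (unitaryGroupOfForm σ ((StdForm.antidiagonal 3).over K))) k) = 1 ∧
      Nat.card (fixedBy (↥(unitaryGroupOfForm σ ((StdForm.antidiagonal 3).over K)) ⧸
        ((glInt 3 K).map (MulAut.conj g₁).toMonoidHom).subgroupOf (unitaryGroupOfForm σ ((StdForm.antidiagonal 3).over K))) k) = 0 := by
  classical
  have hϖ0 : ϖ ≠ 0 := uniformizer_ne_zero hd.vϖ
  have hϖ1 : Valued.v ϖ ≤ 1 := uniformizer_mem_integer hd.vϖ
  have hT := isTree_latticeGraph_three_of_unramified (K := K) hd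
  set G := latticeGraph σ ϖ ((StdForm.antidiagonal 3).over K) with hG
  set root : {M : Submodule 𝒪[K] (Fin 3 → K) // IsVertex σ ϖ ((StdForm.antidiagonal 3).over K) M} :=
    ⟨stdLattice K 3, 0, isSelfDualLattice_stdLattice_three hd⟩ with hroot_def
  set φ := latticeGraphIso σ ϖ ((StdForm.antidiagonal 3).over K) k with hφ
  -- the root is fixed
  have hroot : φ root = root := by
    rw [hφ, latticeGraphIso_apply_eq_self_iff]
    exact mapGL_stdLattice_of_mem_unitaryInt hk
  -- no star vertex is fixed: ★ 3b + finiteness of the star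
  obtain ⟨σk, hσk⟩ := exists_residueField_ringHom_of_v_eq hd.vσ
  have hstarfin : (G.neighborSet root).Finite := finite_neighborSet_root hd (map_mem_integer_of_v_eq hd.vσ) σk hσk
  have hempty : {w : {M : Submodule 𝒪[K] (Fin 3 → K) // IsVertex σ ϖ ((StdForm.antidiagonal 3).over K) M} |
      w ∈ G.neighborSet root ∧ φ w = w} = ∅ := by
    have h0 := ncard_fixed_neighborSet_root_eq_zero_of_residually_regular hd k hk P hP hP' u hkP hreg hanis
    exact (Set.ncard_eq_zero (hstarfin.subset fun w hw => hw.1)).1 h0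
  -- every fixed vertex is the root (convexity of the fixed set on the tree)
  have hfix : ∀ v, φ v = v → v = root := by
    intro v hv
    by_contra hne
    have hconn := hT.1
    have hpos : 0 < G.dist root v := hconn.pos_dist_of_ne (Ne.symm hne)
    obtain ⟨p, hp⟩ := hconn.exists_walk_length_eq_dist root v
    -- the first vertex `z` of the geodesic
    have hadj : G.Adj root (p.getVert 1) := by
      have h := p.adj_getVert_succ (i := 0) (by rw [hp]; exact hpos)
      rwa [SimpleGraph.Walk.getVert_zero] at h
    have hz1 : G.dist root (p.getVert 1) = 1 := SimpleGraph.dist_eq_one_iff_adj.2 hadj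
    have hzv : G.dist (p.getVert 1) v ≤ G.dist root v - 1 := by
      have h := SimpleGraph.dist_le (p.drop 1)
      rw [SimpleGraph.Walk.drop_length, hp] at h
      exact h
    have htri : G.dist root v ≤ G.dist root (p.getVert 1) + G.dist (p.getVert 1) v := hconn.dist_triangle
    have hsum : G.dist root (p.getVert 1) + G.dist (p.getVert 1) v = G.dist root v := by rw [hz1] at htri ⊢; omega
    have hzfix : φ (p.getVert 1) = p.getVert 1 := fixedPoints_convex_of_isTree G hT φ hroot hv hsum
    have hmem : p.getVert 1 ∈ {w : {M : Submodule 𝒪[K] (Fin 3 → K) // IsVertex σ ϖ ((StdForm.antidiagonal 3).over K) M} |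
        w ∈ G.neighborSet root ∧ φ w = w} := ⟨hadj, hzfix⟩
    rw [hempty] at hmem
    exact hmem
  -- the dictionaries (A) and (B), with transitivity from the unramified datum (as in ★ EP)
  have hrootsd : IsSelfDualLattice σ ϖ ((StdForm.antidiagonal 3).over K) (stdLattice K 3) := isSelfDualLattice_stdLattice_three hd
  have hN₁ : mapGL g₁ (stdLattice K 3) = latt (Matrix.diagonal ![(1 : K), 1, ϖ]) := by rw [← hg₁]; rfl
  have hg₁2 : IsVertexLattice σ ϖ ((StdForm.antidiagonal 3).over K) 2 (mapGL g₁ (stdLattice K 3)) := by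
    rw [hN₁]; exact isVertexLattice_two_latt_diagonal_one_one hd.σϖ hϖ1 hϖ0
  have hA : ∀ M : Submodule (Valued.integer K) (Fin 3 → K), IsSelfDualLattice σ ϖ ((StdForm.antidiagonal 3).over K) M →
      ∃ w : ↥(unitaryGroupOfForm σ ((StdForm.antidiagonal 3).over K)), mapGL (w : GL (Fin 3) K) (stdLattice K 3) = M := fun M hM =>
    exists_unitary_mapGL_stdLattice_eq_of_isSelfDualLattice_of_trace hd.σσ hd.vσ hd.vϖ hd.trace hM
  have hB : ∀ M : Submodule (Valued.integer K) (Fin 3 → K), IsVertexLattice σ ϖ ((StdForm.antidiagonal 3).over K) 2 M →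
      ∃ w : ↥(unitaryGroupOfForm σ ((StdForm.antidiagonal 3).over K)), mapGL ((w : GL (Fin 3) K) * g₁) (stdLattice K 3) = M := by
    intro M hM
    obtain ⟨w, hw⟩ := forall_isVertexLattice_two_exists_mapGL_N₁_eq hd M hM
    exact ⟨w, by rw [mapGL_mul, hN₁, hw]⟩
  obtain ⟨eA, -⟩ := exists_fixedBy_equiv_fixed_selfDual_rankN σ ϖ _ hrootsd hA k
  obtain ⟨eB, -⟩ := exists_fixedBy_conj_equiv_fixed_type σ ϖ _ hg₁2 hB k
  constructor
  · -- the fixed self-dual vertices are `{root}`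
    have hS : {v : {M : Submodule (Valued.integer K) (Fin 3 → K) // IsVertex σ ϖ ((StdForm.antidiagonal 3).over K) M} |
        latticeGraphIso σ ϖ ((StdForm.antidiagonal 3).over K) k v = v ∧ IsSelfDualLattice σ ϖ ((StdForm.antidiagonal 3).over K) v.1} = {root} := by
      ext v
      simp only [Set.mem_setOf_eq, Set.mem_singleton_iff]
      exact ⟨fun h => hfix v h.1, fun h => by subst h; exact ⟨hroot, hrootsd⟩⟩
    rw [Nat.card_congr eA, Nat.card_coe_set_eq, hS, Set.ncard_singleton]
  · -- no type-two vertex is fixed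
    have hS : {v : {M : Submodule (Valued.integer K) (Fin 3 → K) // IsVertex σ ϖ ((StdForm.antidiagonal 3).over K) M} |
        latticeGraphIso σ ϖ ((StdForm.antidiagonal 3).over K) k v = v ∧ IsVertexLattice σ ϖ ((StdForm.antidiagonal 3).over K) 2 v.1} = ∅ := by
      ext v
      simp only [Set.mem_setOf_eq, Set.mem_empty_iff_false, iff_false, not_and]
      intro hv h2
      have hvr : v = root := hfix v hv
      rw [hvr] at h2
      exact not_isSelfDualLattice_of_isVertexLattice_two hd h2 hrootsd
    rw [Nat.card_congr eB, Nat.card_coe_set_eq, hS, Set.ncard_empty]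

end Summit.HodgeConjecture.HodgeConjecture.R90.S6

end
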